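import Literature.Computability.AlgebraicComplexity.SkewAdjugateRankOne
import Literature.Computability.AlgebraicComplexity.LMR13PLambdaStabilizerBlockI
import Literature.Computability.AlgebraicComplexity.LMR13PLambdaStabilizerThree
import Literature.Computability.AlgebraicComplexity.LMR13BoundaryMaximality
import Literature.Computability.AlgebraicComplexity.DetOrbitClosureDimension
import Mathlib.LinearAlgebra.Dimension.Constructions
import HarnessLib

/-!
# LMR13 §3.5, stabiliser of `P_Λ`: assembly — `dim 𝔤𝔩(W)_{P_Λ} ≤ 2n² − 1` from the three blocks

[topic Computability/AlgebraicComplexity]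

Landsberg–Manivel–Ressayre 2013, §3.5 (journal p. 481; arXiv:1004.4802 `p0008.txt:L82–88`): "`𝔤𝔩(W)_{P_Λ}` has
dimension `2n²`" (projectively; affinely `2n² − 1`), "one more than the stabilizer of `[det_n]`", whence
Prop. 3.5.1 (codimension one). The cell's elementary route (memo `HOME/lmr/X3b-ELEMENTARY-ROUTE-t10g4.md` §6)
assembles the upper bound from three blocks of the identity `X·P_Λ = 0` split by `(A,S)`-bidegree
(`pLambda_glAnn_blocks`): (I) `(L_X A)_sym`, (II) `(L_X S)_skew` (PROVED, `skewPart_linAct_eq_zero_of_row_eq_zero`),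
(III) `(L_X A)_skew` & `(L_X S)_sym`, where `(L_X M)_b = Σ_a X_{ab} M_a`. This file is the ASSEMBLY:

* `linAct_single`, `eq_zero_of_linAct_skew_eq_zero_of_linAct_sym_eq_zero` — `X` is recovered from `L_X` on
  skew and symmetric matrices;
* `skewPart_linAct_eq_zero_of_sym` — block (II) for every symmetric `S` (`n ≥ 3`);
* `symPart_linAct_eq_zero_of_sym` — the `(L_X S)_sym` half of block (III) once `(L_X A)_skew = 0`, by the
  rank-one adjugates (`eq_zero_of_forall_skew_trace_adjugate_mul`, `SkewAdjugateRankOne.lean`);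
* `eq_zero_of_mem_glAnn_of_functionals` — given the block-(I) and block-(III) theorems AS HYPOTHESES (their
  proofs are the cell's separate files), an `X ∈ 𝔤𝔩(W)_{P_Λ}` killed by the `(n²−1) + n²` coordinate functionals
  `f_{ab} = (L_X(E_ab − E_ba))_{bb}`, `g_j = (L_X(E_0j − E_j0))_{0j} + (…)_{j0}`, `Φ_{ra} = (L_X(E_ra + E_ar))_{rr}`,
  `Ψ_j = (L_X(E_0j − E_j0))_{0j} − (…)_{j0}`, `Ψ₁₂` vanishes;
* `finrank_glAnn_pLambda_le_of_blocks` — hence **`finrank ℂ 𝔤𝔩(W)_{P_Λ} ≤ 2n² − 1`** (`n = h+h+1`), by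
  `LinearMap.finrank_le_finrank_of_injective` for the functional map into `ℂ^{2n²−1}`.

Theorems only; no named fact. Honest framing: conditional assembly (the block theorems enter as hypotheses);
`LMR2013_prop_3_5_1` remains OPEN in the tree for `n > 3` until blocks (I) and (III) land; VP ≠ VNP is NOT
proved and nothing here is progress on it.

## References

* [LandsbergManivelRessayre2013] J. M. Landsberg, L. Manivel, N. Ressayre, *Hypersurfaces with degenerate duals and
  the geometric complexity theory program*, Comment. Math. Helv. 88 (2013) 469–484, §3.5 (p. 481).
-/

noncomputable section

open Matrix

namespace Literature.Computability.AlgebraicComplexity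

namespace SkewAdj

variable {n : ℕ}

/-! ### Recovering `X` from `L_X` -/

/-- `L_X(E_ab) = (X_{(a,b),(k,l)})_{kl}`. [cite: LandsbergManivelRessayre2013, §3.5 (p. 481)] -/
theorem linAct_single (X : Matrix (Fin n × Fin n) (Fin n × Fin n) ℂ) (a b : Fin n) :
    (Matrix.of fun k l => ∑ p : Fin n × Fin n, X p (k, l) * Matrix.single a b (1 : ℂ) p.1 p.2) =
      Matrix.of fun k l => X (a, b) (k, l) := by
  ext k l
  rw [Matrix.of_apply, Matrix.of_apply, Fintype.sum_eq_single (a, b)]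
  · rw [Matrix.single_apply_same, mul_one]
  · intro p hp
    rw [Matrix.single_apply_of_ne, mul_zero]
    exact fun h => hp (Prod.ext h.1.symm h.2.symm)

/-- **`X = 0` as soon as `L_X` kills all skew and all symmetric matrices** (`E_ab` is the sum of its
symmetric and skew parts). [cite: LandsbergManivelRessayre2013, §3.5 (p. 481)] -/
theorem eq_zero_of_linAct_skew_eq_zero_of_linAct_sym_eq_zero {X : Matrix (Fin n × Fin n) (Fin n × Fin n) ℂ}
    (hskew : ∀ A : Matrix (Fin n) (Fin n) ℂ, Aᵀ = -A →
      (Matrix.of fun k l => ∑ p : Fin n × Fin n, X p (k, l) * A p.1 p.2) = 0)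
    (hsym : ∀ S : Matrix (Fin n) (Fin n) ℂ, Sᵀ = S →
      (Matrix.of fun k l => ∑ p : Fin n × Fin n, X p (k, l) * S p.1 p.2) = 0) :
    X = 0 := by
  ext ⟨a, b⟩ ⟨k, l⟩
  have h1 := hsym (Matrix.single a b (1 : ℂ) + Matrix.single b a 1)
    (by rw [Matrix.transpose_add, Matrix.transpose_single, Matrix.transpose_single, add_comm])
  have h2 := hskew (Matrix.single a b (1 : ℂ) - Matrix.single b a 1)
    (by rw [Matrix.transpose_sub, Matrix.transpose_single, Matrix.transpose_single, neg_sub])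
  rw [linAct_add, linAct_single, linAct_single] at h1
  rw [linAct_sub, linAct_single, linAct_single] at h2
  have e1 := congrFun (congrFun h1 k) l
  have e2 := congrFun (congrFun h2 k) l
  simp only [Matrix.add_apply, Matrix.sub_apply, Matrix.of_apply, Matrix.zero_apply] at e1 e2
  rw [Matrix.zero_apply]
  linear_combination (e1 + e2) / 2

/-! ### Block (II) for every symmetric matrix, and the `(L_X S)_sym` half of block (III) -/

/-- A symmetric matrix is the combination `Σ_{i,j} (S_ij/2)·(E_ij + E_ji)`. [cite: LandsbergManivelRessayre2013, §3.5 (p. 481)] -/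
theorem sym_eq_sum_single_add_single {S : Matrix (Fin n) (Fin n) ℂ} (hS : Sᵀ = S) :
    S = ∑ i, ∑ j, (S i j / 2) • (Matrix.single i j (1 : ℂ) + Matrix.single j i 1) := by
  ext k l
  have hkl : S l k = S k l := by
    have := congrFun (congrFun hS k) l
    rwa [Matrix.transpose_apply] at this
  simp only [Matrix.sum_apply, Matrix.smul_apply, Matrix.add_apply, smul_eq_mul]
  have inner : ∀ i, (∑ j, S i j / 2 * (Matrix.single i j (1 : ℂ) k l + Matrix.single j i (1 : ℂ) k l)) =
      (if i = k then S k l / 2 else 0) + (if i = l then S l k / 2 else 0) := by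
    intro i
    simp only [mul_add, Finset.sum_add_distrib, Matrix.single_apply, mul_ite, mul_one, mul_zero]
    congr 1
    · by_cases hik : i = k
      · subst hik
        rw [if_pos rfl, Finset.sum_eq_single l (fun j _ hj => if_neg (fun h => hj h.2))
          (fun h => absurd (Finset.mem_univ l) h), if_pos ⟨rfl, rfl⟩]
      · rw [if_neg hik]
        exact Finset.sum_eq_zero fun j _ => if_neg fun h => hik h.1
    · by_cases hil : i = l
      · subst hil
        rw [if_pos rfl, Finset.sum_eq_single k (fun j _ hj => if_neg (fun h => hj h.1))
          (fun h => absurd (Finset.mem_univ k) h), if_pos ⟨rfl, rfl⟩]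
      · rw [if_neg hil]
        exact Finset.sum_eq_zero fun j _ => if_neg fun h => hil h.2
  simp_rw [inner]
  rw [Finset.sum_add_distrib, Finset.sum_ite_eq' Finset.univ k, Finset.sum_ite_eq' Finset.univ l,
    if_pos (Finset.mem_univ _), if_pos (Finset.mem_univ _), hkl]
  ring

/-- `L_X` of a double sum of scalar multiples. [cite: LandsbergManivelRessayre2013, §3.5 (p. 481)] -/
theorem linAct_sum_sum_smul (X : Matrix (Fin n × Fin n) (Fin n × Fin n) ℂ) (c : Fin n → Fin n → ℂ)
    (M : Fin n → Fin n → Matrix (Fin n) (Fin n) ℂ) :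
    (Matrix.of fun k l => ∑ p : Fin n × Fin n, X p (k, l) * (∑ i, ∑ j, c i j • M i j) p.1 p.2) =
      ∑ i, ∑ j, c i j • (Matrix.of fun k l => ∑ p : Fin n × Fin n, X p (k, l) * M i j p.1 p.2) := by
  ext k l
  simp only [Matrix.of_apply, Matrix.sum_apply, Matrix.smul_apply, smul_eq_mul, Finset.mul_sum]
  rw [Finset.sum_comm]
  refine Finset.sum_congr rfl fun i _ => ?_
  rw [Finset.sum_comm]
  exact Finset.sum_congr rfl fun j _ => Finset.sum_congr rfl fun p _ => by ring

/-- A third index in `Fin (h+h+1)`, `h ≥ 1`. [cite: LandsbergManivelRessayre2013, §3.5 (p. 481)] -/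
theorem exists_ne_ne_of_one_le {h : ℕ} (hh : 1 ≤ h) (i j : Fin (h + h + 1)) :
    ∃ r : Fin (h + h + 1), r ≠ i ∧ r ≠ j := by
  classical
  have hcard : 0 < ((Finset.univ.erase i).erase j).card := by
    have h1 : (Finset.univ.erase i).card = h + h + 1 - 1 := by
      rw [Finset.card_erase_of_mem (Finset.mem_univ i), Finset.card_univ, Fintype.card_fin]
    have h2 := Finset.pred_card_le_card_erase (s := Finset.univ.erase i) (a := j)
    omega
  obtain ⟨r, hr⟩ := Finset.card_pos.mp hcard
  simp only [Finset.mem_erase, Finset.mem_univ, and_true] at hr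
  exact ⟨r, hr.2, hr.1⟩

/-- **Block (II) for every symmetric `S`** (`n = h+h+1 ≥ 3`): `(L_X S)_skew = 0` — from val-lit-t10's
`skewPart_linAct_single_add_single_eq_zero` on the spanning family `E_ij + E_ji` (each has a zero row when
`n ≥ 3`). [cite: LandsbergManivelRessayre2013, §3.5 (p. 481)] -/
theorem skewPart_linAct_eq_zero_of_sym {h : ℕ} (hh : 1 ≤ h)
    {X : Matrix (Fin (h + h + 1) × Fin (h + h + 1)) (Fin (h + h + 1) × Fin (h + h + 1)) ℂ}
    (hX : X ∈ glAnn (pLambda (h + h + 1))) {S : Matrix (Fin (h + h + 1)) (Fin (h + h + 1)) ℂ} (hS : Sᵀ = S) :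
    (1 / 2 : ℂ) • ((Matrix.of fun k l => ∑ p : Fin (h + h + 1) × Fin (h + h + 1), X p (k, l) * S p.1 p.2) -
      (Matrix.of fun k l => ∑ p : Fin (h + h + 1) × Fin (h + h + 1), X p (k, l) * S p.1 p.2)ᵀ) = 0 := by
  rw [sym_eq_sum_single_add_single hS, linAct_sum_sum_smul]
  simp only [Matrix.transpose_sum, Matrix.transpose_smul, ← Finset.sum_sub_distrib, ← smul_sub, Finset.smul_sum]
  refine Finset.sum_eq_zero fun i _ => Finset.sum_eq_zero fun j _ => ?_
  obtain ⟨r, hri, hrj⟩ := exists_ne_ne_of_one_le hh i j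
  rw [smul_comm, skewPart_linAct_single_add_single_eq_zero hX hri hrj, smul_zero]

/-- **The `(L_X S)_sym` half of block (III)** (`n = h+h+1 ≥ 3`): once `(L_X A)_skew = 0` for all skew `A`,
identity (III) reads `tr(adj A · (L_X S)_sym) = 0` for all skew `A`, so `(L_X S)_sym = 0` by the rank-one adjugates
(`eq_zero_of_forall_skew_trace_adjugate_mul`). [cite: LandsbergManivelRessayre2013, §3.5 (p. 481)] -/
theorem symPart_linAct_eq_zero_of_sym {h : ℕ} (hh : 1 ≤ h)
    {X : Matrix (Fin (h + h + 1) × Fin (h + h + 1)) (Fin (h + h + 1) × Fin (h + h + 1)) ℂ}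
    (hX : X ∈ glAnn (pLambda (h + h + 1)))
    (hα : ∀ A : Matrix (Fin (h + h + 1)) (Fin (h + h + 1)) ℂ, Aᵀ = -A →
      (1 / 2 : ℂ) • ((Matrix.of fun k l => ∑ p : Fin (h + h + 1) × Fin (h + h + 1), X p (k, l) * A p.1 p.2) -
        (Matrix.of fun k l => ∑ p : Fin (h + h + 1) × Fin (h + h + 1), X p (k, l) * A p.1 p.2)ᵀ) = 0)
    {S : Matrix (Fin (h + h + 1)) (Fin (h + h + 1)) ℂ} (hS : Sᵀ = S) :
    (1 / 2 : ℂ) • ((Matrix.of fun k l => ∑ p : Fin (h + h + 1) × Fin (h + h + 1), X p (k, l) * S p.1 p.2) +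
      (Matrix.of fun k l => ∑ p : Fin (h + h + 1) × Fin (h + h + 1), X p (k, l) * S p.1 p.2)ᵀ) = 0 := by
  refine eq_zero_of_forall_skew_trace_adjugate_mul hh ?_ fun A hA => ?_
  · rw [Matrix.transpose_smul, Matrix.transpose_add, Matrix.transpose_transpose]
    congr 1
    exact add_comm _ _
  · have h3 := (pLambda_glAnn_blocks (Nat.succ_ne_zero _) hX hA hS).2.1
    rwa [hα A hA, adjDeriv_zero, Matrix.zero_mul, Matrix.trace_zero, add_zero] at h3

/-! ### The assembly: injectivity of the functionals and the dimension bound -/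

section Assembly

variable {h : ℕ}

/-- **`X ∈ 𝔤𝔩(W)_{P_Λ}` killed by the `2n² − 1` functionals is `0`** (`n = h+h+1 ≥ 3`), GIVEN the block-(I) and
block-(III) theorems of the route as hypotheses `blockI`, `blockIII` (memo §6: blocks (I)–(III) give `L_X = 0` on
skew and on symmetric matrices, hence `X = 0`). [cite: LandsbergManivelRessayre2013, §3.5 (p. 481)] -/
theorem eq_zero_of_mem_glAnn_of_functionals (hh : 1 ≤ h)
    (blockI : ∀ X : Matrix (Fin (h + h + 1) × Fin (h + h + 1)) (Fin (h + h + 1) × Fin (h + h + 1)) ℂ,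
      X ∈ glAnn (pLambda (h + h + 1)) →
      (∀ a b : Fin (h + h + 1), a ≠ b →
        (Matrix.of fun k l => ∑ p : Fin (h + h + 1) × Fin (h + h + 1), X p (k, l) *
          (Matrix.single a b (1 : ℂ) - Matrix.single b a (1 : ℂ)) p.1 p.2) b b = 0) →
      (∀ j : Fin (h + h + 1), j ≠ 0 →
        (Matrix.of fun k l => ∑ p : Fin (h + h + 1) × Fin (h + h + 1), X p (k, l) *
            (Matrix.single (0 : Fin (h + h + 1)) j (1 : ℂ) - Matrix.single j (0 : Fin (h + h + 1)) (1 : ℂ)) p.1 p.2) 0 j +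
          (Matrix.of fun k l => ∑ p : Fin (h + h + 1) × Fin (h + h + 1), X p (k, l) *
            (Matrix.single (0 : Fin (h + h + 1)) j (1 : ℂ) - Matrix.single j (0 : Fin (h + h + 1)) (1 : ℂ)) p.1 p.2) j 0 = 0) →
      ∀ A : Matrix (Fin (h + h + 1)) (Fin (h + h + 1)) ℂ, Aᵀ = -A →
        (1 / 2 : ℂ) • ((Matrix.of fun k l => ∑ p : Fin (h + h + 1) × Fin (h + h + 1), X p (k, l) * A p.1 p.2) +
          (Matrix.of fun k l => ∑ p : Fin (h + h + 1) × Fin (h + h + 1), X p (k, l) * A p.1 p.2)ᵀ) = 0)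
    (blockIII : ∀ X : Matrix (Fin (h + h + 1) × Fin (h + h + 1)) (Fin (h + h + 1) × Fin (h + h + 1)) ℂ,
      X ∈ glAnn (pLambda (h + h + 1)) →
      (∀ r a : Fin (h + h + 1), r ≠ a →
        (Matrix.of fun k l => ∑ p : Fin (h + h + 1) × Fin (h + h + 1), X p (k, l) *
          (Matrix.single r a (1 : ℂ) + Matrix.single a r (1 : ℂ)) p.1 p.2) r r = 0) →
      (∀ j : Fin (h + h + 1), j ≠ 0 →
        (Matrix.of fun k l => ∑ p : Fin (h + h + 1) × Fin (h + h + 1), X p (k, l) *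
            (Matrix.single (0 : Fin (h + h + 1)) j (1 : ℂ) - Matrix.single j (0 : Fin (h + h + 1)) (1 : ℂ)) p.1 p.2) 0 j -
          (Matrix.of fun k l => ∑ p : Fin (h + h + 1) × Fin (h + h + 1), X p (k, l) *
            (Matrix.single (0 : Fin (h + h + 1)) j (1 : ℂ) - Matrix.single j (0 : Fin (h + h + 1)) (1 : ℂ)) p.1 p.2) j 0 = 0) →
      ((Matrix.of fun k l => ∑ p : Fin (h + h + 1) × Fin (h + h + 1), X p (k, l) *
            (Matrix.single (⟨1, by omega⟩ : Fin (h + h + 1)) (⟨2, by omega⟩ : Fin (h + h + 1)) (1 : ℂ) -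
              Matrix.single (⟨2, by omega⟩ : Fin (h + h + 1)) (⟨1, by omega⟩ : Fin (h + h + 1)) (1 : ℂ)) p.1 p.2)
            (⟨1, by omega⟩ : Fin (h + h + 1)) (⟨2, by omega⟩ : Fin (h + h + 1)) -
        (Matrix.of fun k l => ∑ p : Fin (h + h + 1) × Fin (h + h + 1), X p (k, l) *
            (Matrix.single (⟨1, by omega⟩ : Fin (h + h + 1)) (⟨2, by omega⟩ : Fin (h + h + 1)) (1 : ℂ) -
              Matrix.single (⟨2, by omega⟩ : Fin (h + h + 1)) (⟨1, by omega⟩ : Fin (h + h + 1)) (1 : ℂ)) p.1 p.2)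
            (⟨2, by omega⟩ : Fin (h + h + 1)) (⟨1, by omega⟩ : Fin (h + h + 1)) = 0) →
      ∀ A : Matrix (Fin (h + h + 1)) (Fin (h + h + 1)) ℂ, Aᵀ = -A →
        (1 / 2 : ℂ) • ((Matrix.of fun k l => ∑ p : Fin (h + h + 1) × Fin (h + h + 1), X p (k, l) * A p.1 p.2) -
          (Matrix.of fun k l => ∑ p : Fin (h + h + 1) × Fin (h + h + 1), X p (k, l) * A p.1 p.2)ᵀ) = 0)
    {X : Matrix (Fin (h + h + 1) × Fin (h + h + 1)) (Fin (h + h + 1) × Fin (h + h + 1)) ℂ}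
    (hX : X ∈ glAnn (pLambda (h + h + 1)))
    (hf : ∀ a b : Fin (h + h + 1), a ≠ b →
      (Matrix.of fun k l => ∑ p : Fin (h + h + 1) × Fin (h + h + 1), X p (k, l) *
        (Matrix.single a b (1 : ℂ) - Matrix.single b a (1 : ℂ)) p.1 p.2) b b = 0)
    (hg : ∀ j : Fin (h + h + 1), j ≠ 0 →
      (Matrix.of fun k l => ∑ p : Fin (h + h + 1) × Fin (h + h + 1), X p (k, l) *
          (Matrix.single (0 : Fin (h + h + 1)) j (1 : ℂ) - Matrix.single j (0 : Fin (h + h + 1)) (1 : ℂ)) p.1 p.2) 0 j +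
        (Matrix.of fun k l => ∑ p : Fin (h + h + 1) × Fin (h + h + 1), X p (k, l) *
          (Matrix.single (0 : Fin (h + h + 1)) j (1 : ℂ) - Matrix.single j (0 : Fin (h + h + 1)) (1 : ℂ)) p.1 p.2) j 0 = 0)
    (hΦ : ∀ r a : Fin (h + h + 1), r ≠ a →
      (Matrix.of fun k l => ∑ p : Fin (h + h + 1) × Fin (h + h + 1), X p (k, l) *
        (Matrix.single r a (1 : ℂ) + Matrix.single a r (1 : ℂ)) p.1 p.2) r r = 0)
    (hΨ : ∀ j : Fin (h + h + 1), j ≠ 0 →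
      (Matrix.of fun k l => ∑ p : Fin (h + h + 1) × Fin (h + h + 1), X p (k, l) *
          (Matrix.single (0 : Fin (h + h + 1)) j (1 : ℂ) - Matrix.single j (0 : Fin (h + h + 1)) (1 : ℂ)) p.1 p.2) 0 j -
        (Matrix.of fun k l => ∑ p : Fin (h + h + 1) × Fin (h + h + 1), X p (k, l) *
          (Matrix.single (0 : Fin (h + h + 1)) j (1 : ℂ) - Matrix.single j (0 : Fin (h + h + 1)) (1 : ℂ)) p.1 p.2) j 0 = 0)
    (hΨ12 : (Matrix.of fun k l => ∑ p : Fin (h + h + 1) × Fin (h + h + 1), X p (k, l) *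
            (Matrix.single (⟨1, by omega⟩ : Fin (h + h + 1)) (⟨2, by omega⟩ : Fin (h + h + 1)) (1 : ℂ) -
              Matrix.single (⟨2, by omega⟩ : Fin (h + h + 1)) (⟨1, by omega⟩ : Fin (h + h + 1)) (1 : ℂ)) p.1 p.2)
            (⟨1, by omega⟩ : Fin (h + h + 1)) (⟨2, by omega⟩ : Fin (h + h + 1)) -
        (Matrix.of fun k l => ∑ p : Fin (h + h + 1) × Fin (h + h + 1), X p (k, l) *
            (Matrix.single (⟨1, by omega⟩ : Fin (h + h + 1)) (⟨2, by omega⟩ : Fin (h + h + 1)) (1 : ℂ) -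
              Matrix.single (⟨2, by omega⟩ : Fin (h + h + 1)) (⟨1, by omega⟩ : Fin (h + h + 1)) (1 : ℂ)) p.1 p.2)
            (⟨2, by omega⟩ : Fin (h + h + 1)) (⟨1, by omega⟩ : Fin (h + h + 1)) = 0) :
    X = 0 := by
  have hα := blockIII X hX hΦ hΨ hΨ12
  have hψ := blockI X hX hf hg
  have split : ∀ L : Matrix (Fin (h + h + 1)) (Fin (h + h + 1)) ℂ,
      L = (1 / 2 : ℂ) • (L + Lᵀ) + (1 / 2 : ℂ) • (L - Lᵀ) := by
    intro L
    ext k l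
    simp only [Matrix.add_apply, Matrix.sub_apply, Matrix.smul_apply, Matrix.transpose_apply, smul_eq_mul]
    ring
  refine eq_zero_of_linAct_skew_eq_zero_of_linAct_sym_eq_zero (fun A hA => ?_) (fun S hS => ?_)
  · rw [split (Matrix.of fun k l => ∑ p : Fin (h + h + 1) × Fin (h + h + 1), X p (k, l) * A p.1 p.2),
      hψ A hA, hα A hA, add_zero]
  · rw [split (Matrix.of fun k l => ∑ p : Fin (h + h + 1) × Fin (h + h + 1), X p (k, l) * S p.1 p.2),
      symPart_linAct_eq_zero_of_sym hh hX hα hS, skewPart_linAct_eq_zero_of_sym hh hX hS, add_zero]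


/-- **`dim 𝔤𝔩(W)_{P_Λ} ≤ 2n² − 1` from the blocks** (`n = h+h+1 ≥ 3`; LMR 2013 §3.5: "`𝔤𝔩(W)_{P_Λ}` has
dimension `2n²`" projectively): the `ℂ`-linear map `Θ` of the `(n²−n) + (n−1) + (n²−n) + (n−1) + 1 = 2n² − 1`
coordinate functionals `f, g, Φ, Ψ, Ψ₁₂` is injective on `𝔤𝔩(W)_{P_Λ}` by `eq_zero_of_mem_glAnn_of_functionals`
(block theorems (I), (III) as hypotheses), so `finrank ≤ 2n² − 1` (`LinearMap.finrank_le_finrank_of_injective`).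
[cite: LandsbergManivelRessayre2013, Proposition 3.5.1 (p. 481)] -/
theorem finrank_glAnn_pLambda_le_of_blocks (hh : 1 ≤ h)
    (blockI : ∀ X : Matrix (Fin (h + h + 1) × Fin (h + h + 1)) (Fin (h + h + 1) × Fin (h + h + 1)) ℂ,
      X ∈ glAnn (pLambda (h + h + 1)) →
      (∀ a b : Fin (h + h + 1), a ≠ b →
        (Matrix.of fun k l => ∑ p : Fin (h + h + 1) × Fin (h + h + 1), X p (k, l) *
          (Matrix.single a b (1 : ℂ) - Matrix.single b a (1 : ℂ)) p.1 p.2) b b = 0) →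
      (∀ j : Fin (h + h + 1), j ≠ 0 →
        (Matrix.of fun k l => ∑ p : Fin (h + h + 1) × Fin (h + h + 1), X p (k, l) *
            (Matrix.single (0 : Fin (h + h + 1)) j (1 : ℂ) - Matrix.single j (0 : Fin (h + h + 1)) (1 : ℂ)) p.1 p.2) 0 j +
          (Matrix.of fun k l => ∑ p : Fin (h + h + 1) × Fin (h + h + 1), X p (k, l) *
            (Matrix.single (0 : Fin (h + h + 1)) j (1 : ℂ) - Matrix.single j (0 : Fin (h + h + 1)) (1 : ℂ)) p.1 p.2) j 0 = 0) →
      ∀ A : Matrix (Fin (h + h + 1)) (Fin (h + h + 1)) ℂ, Aᵀ = -A →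
        (1 / 2 : ℂ) • ((Matrix.of fun k l => ∑ p : Fin (h + h + 1) × Fin (h + h + 1), X p (k, l) * A p.1 p.2) +
          (Matrix.of fun k l => ∑ p : Fin (h + h + 1) × Fin (h + h + 1), X p (k, l) * A p.1 p.2)ᵀ) = 0)
    (blockIII : ∀ X : Matrix (Fin (h + h + 1) × Fin (h + h + 1)) (Fin (h + h + 1) × Fin (h + h + 1)) ℂ,
      X ∈ glAnn (pLambda (h + h + 1)) →
      (∀ r a : Fin (h + h + 1), r ≠ a →
        (Matrix.of fun k l => ∑ p : Fin (h + h + 1) × Fin (h + h + 1), X p (k, l) *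
          (Matrix.single r a (1 : ℂ) + Matrix.single a r (1 : ℂ)) p.1 p.2) r r = 0) →
      (∀ j : Fin (h + h + 1), j ≠ 0 →
        (Matrix.of fun k l => ∑ p : Fin (h + h + 1) × Fin (h + h + 1), X p (k, l) *
            (Matrix.single (0 : Fin (h + h + 1)) j (1 : ℂ) - Matrix.single j (0 : Fin (h + h + 1)) (1 : ℂ)) p.1 p.2) 0 j -
          (Matrix.of fun k l => ∑ p : Fin (h + h + 1) × Fin (h + h + 1), X p (k, l) *
            (Matrix.single (0 : Fin (h + h + 1)) j (1 : ℂ) - Matrix.single j (0 : Fin (h + h + 1)) (1 : ℂ)) p.1 p.2) j 0 = 0) →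
      ((Matrix.of fun k l => ∑ p : Fin (h + h + 1) × Fin (h + h + 1), X p (k, l) *
            (Matrix.single (⟨1, by omega⟩ : Fin (h + h + 1)) (⟨2, by omega⟩ : Fin (h + h + 1)) (1 : ℂ) -
              Matrix.single (⟨2, by omega⟩ : Fin (h + h + 1)) (⟨1, by omega⟩ : Fin (h + h + 1)) (1 : ℂ)) p.1 p.2)
            (⟨1, by omega⟩ : Fin (h + h + 1)) (⟨2, by omega⟩ : Fin (h + h + 1)) -
        (Matrix.of fun k l => ∑ p : Fin (h + h + 1) × Fin (h + h + 1), X p (k, l) *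
            (Matrix.single (⟨1, by omega⟩ : Fin (h + h + 1)) (⟨2, by omega⟩ : Fin (h + h + 1)) (1 : ℂ) -
              Matrix.single (⟨2, by omega⟩ : Fin (h + h + 1)) (⟨1, by omega⟩ : Fin (h + h + 1)) (1 : ℂ)) p.1 p.2)
            (⟨2, by omega⟩ : Fin (h + h + 1)) (⟨1, by omega⟩ : Fin (h + h + 1)) = 0) →
      ∀ A : Matrix (Fin (h + h + 1)) (Fin (h + h + 1)) ℂ, Aᵀ = -A →
        (1 / 2 : ℂ) • ((Matrix.of fun k l => ∑ p : Fin (h + h + 1) × Fin (h + h + 1), X p (k, l) * A p.1 p.2) -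
          (Matrix.of fun k l => ∑ p : Fin (h + h + 1) × Fin (h + h + 1), X p (k, l) * A p.1 p.2)ᵀ) = 0) :
    Module.finrank ℂ (glAnn (pLambda (h + h + 1))) ≤ 2 * (h + h + 1) ^ 2 - 1 := by
  classical
  set n := h + h + 1 with hn
  -- the index type of the `2n² − 1` functionals
  let P := {p : Fin n × Fin n // p.1 ≠ p.2}
  let J := {j : Fin n // j ≠ 0}
  let ι := (P ⊕ J) ⊕ (P ⊕ (J ⊕ Unit))
  let one : Fin n := ⟨1, by omega⟩
  let two : Fin n := ⟨2, by omega⟩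
  -- the functionals, as entries of `L_X W` for fixed test matrices `W`
  let L : Matrix (Fin n × Fin n) (Fin n × Fin n) ℂ → Matrix (Fin n) (Fin n) ℂ → Matrix (Fin n) (Fin n) ℂ :=
    fun X W => Matrix.of fun k l => ∑ p : Fin n × Fin n, X p (k, l) * W p.1 p.2
  have hLadd : ∀ X Y W, L (X + Y) W = L X W + L Y W := by
    intro X Y W
    ext k l
    simp only [L, Matrix.of_apply, Matrix.add_apply, add_mul, Finset.sum_add_distrib]
  have hLsmul : ∀ (c : ℂ) X W, L (c • X) W = c • L X W := by
    intro c X W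
    ext k l
    simp only [L, Matrix.of_apply, Matrix.smul_apply, smul_eq_mul, mul_assoc, Finset.mul_sum]
  let Wm : Fin n → Fin n → Matrix (Fin n) (Fin n) ℂ := fun a b => Matrix.single a b (1 : ℂ) - Matrix.single b a 1
  let Sm : Fin n → Fin n → Matrix (Fin n) (Fin n) ℂ := fun a b => Matrix.single a b (1 : ℂ) + Matrix.single b a 1
  let θ : Matrix (Fin n × Fin n) (Fin n × Fin n) ℂ → ι → ℂ := fun X i =>
    match i with
    | Sum.inl (Sum.inl p) => L X (Wm p.1.1 p.1.2) p.1.2 p.1.2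
    | Sum.inl (Sum.inr j) => L X (Wm 0 j.1) 0 j.1 + L X (Wm 0 j.1) j.1 0
    | Sum.inr (Sum.inl p) => L X (Sm p.1.1 p.1.2) p.1.1 p.1.1
    | Sum.inr (Sum.inr (Sum.inl j)) => L X (Wm 0 j.1) 0 j.1 - L X (Wm 0 j.1) j.1 0
    | Sum.inr (Sum.inr (Sum.inr _)) => L X (Wm one two) one two - L X (Wm one two) two one
  let Θ : Matrix (Fin n × Fin n) (Fin n × Fin n) ℂ →ₗ[ℂ] (ι → ℂ) :=
    { toFun := θ
      map_add' := fun X Y => by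
        funext i
        rcases i with ((p | j) | (p | (j | u))) <;>
          simp only [θ, Pi.add_apply, hLadd, Matrix.add_apply] <;> ring
      map_smul' := fun c X => by
        funext i
        rcases i with ((p | j) | (p | (j | u))) <;>
          simp only [θ, Pi.smul_apply, hLsmul, Matrix.smul_apply, smul_eq_mul, RingHom.id_apply] <;> ring }
  -- `Θ` is injective on the annihilator
  have hinj : Function.Injective (Θ.comp (glAnn (pLambda n)).subtype) := by
    rw [← LinearMap.ker_eq_bot, LinearMap.ker_eq_bot']
    intro X hX0
    have hΘ : θ X.1 = 0 := hX0
    apply Subtype.ext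
    refine eq_zero_of_mem_glAnn_of_functionals hh blockI blockIII X.2 ?_ ?_ ?_ ?_ ?_
    · intro a b hab
      exact congrFun hΘ (Sum.inl (Sum.inl ⟨(a, b), hab⟩))
    · intro j hj
      exact congrFun hΘ (Sum.inl (Sum.inr ⟨j, hj⟩))
    · intro r a hra
      exact congrFun hΘ (Sum.inr (Sum.inl ⟨(r, a), hra⟩))
    · intro j hj
      exact congrFun hΘ (Sum.inr (Sum.inr (Sum.inl ⟨j, hj⟩)))
    · exact congrFun hΘ (Sum.inr (Sum.inr (Sum.inr ())))
  -- count
  have hP : Fintype.card P = n * n - n := by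
    have hdiag : Fintype.card {p : Fin n × Fin n // p.1 = p.2} = n := by
      rw [Fintype.card_congr (⟨fun p => p.1.1, fun i => ⟨(i, i), rfl⟩, fun p => Subtype.ext (Prod.ext rfl p.2),
        fun i => rfl⟩ : {p : Fin n × Fin n // p.1 = p.2} ≃ Fin n), Fintype.card_fin]
    simp only [P]
    rw [Fintype.card_subtype_compl, Fintype.card_prod, Fintype.card_fin, hdiag]
  have hJ : Fintype.card J = n - 1 := by
    simp only [J]
    rw [Fintype.card_subtype_compl, Fintype.card_fin, Fintype.card_subtype_eq]
  have hι : Fintype.card ι = 2 * n ^ 2 - 1 := by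
    simp only [ι, Fintype.card_sum, hP, hJ, Fintype.card_unit]
    have h1 : n ≤ n * n := Nat.le_mul_self n
    have h2 : 1 ≤ n := by omega
    rw [sq]
    omega
  have hle := LinearMap.finrank_le_finrank_of_injective hinj
  rwa [Module.finrank_fintype_fun_eq_card, hι] at hle


/-- **LMR 2013 Prop. 3.5.1 from the two block theorems** (all odd `n ≥ 3`): for `n ≥ 5` the blocks give
`finrank 𝔤𝔩(W)_{P_Λ} ≤ 2n² − 1 = finrank 𝔤𝔩(W)_{det_n} + 1` (`finrank_glAnn_pLambda_le_of_blocks`, val-lit-t13's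
`finrank_glAnn_detPoly`), for `n = 3` this is val-lit-p8's `finrank_glAnn_pLambda_three = 17`; then val-lit-t11's
`LMR2013_prop_3_5_1_of_finrank_glAnn_le` (maximality and codimension one from the single inequality).
[cite: LandsbergManivelRessayre2013, Proposition 3.5.1 (p. 481)] -/
theorem LMR2013_prop_3_5_1_of_blocks
    (blockI : ∀ h : ℕ, 2 ≤ h →
      ∀ X : Matrix (Fin (h + h + 1) × Fin (h + h + 1)) (Fin (h + h + 1) × Fin (h + h + 1)) ℂ,
      X ∈ glAnn (pLambda (h + h + 1)) →
      (∀ a b : Fin (h + h + 1), a ≠ b →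
        (Matrix.of fun k l => ∑ p : Fin (h + h + 1) × Fin (h + h + 1), X p (k, l) *
          (Matrix.single a b (1 : ℂ) - Matrix.single b a (1 : ℂ)) p.1 p.2) b b = 0) →
      (∀ j : Fin (h + h + 1), j ≠ 0 →
        (Matrix.of fun k l => ∑ p : Fin (h + h + 1) × Fin (h + h + 1), X p (k, l) *
            (Matrix.single (0 : Fin (h + h + 1)) j (1 : ℂ) - Matrix.single j (0 : Fin (h + h + 1)) (1 : ℂ)) p.1 p.2) 0 j +
          (Matrix.of fun k l => ∑ p : Fin (h + h + 1) × Fin (h + h + 1), X p (k, l) *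
            (Matrix.single (0 : Fin (h + h + 1)) j (1 : ℂ) - Matrix.single j (0 : Fin (h + h + 1)) (1 : ℂ)) p.1 p.2) j 0 = 0) →
      ∀ A : Matrix (Fin (h + h + 1)) (Fin (h + h + 1)) ℂ, Aᵀ = -A →
        (1 / 2 : ℂ) • ((Matrix.of fun k l => ∑ p : Fin (h + h + 1) × Fin (h + h + 1), X p (k, l) * A p.1 p.2) +
          (Matrix.of fun k l => ∑ p : Fin (h + h + 1) × Fin (h + h + 1), X p (k, l) * A p.1 p.2)ᵀ) = 0)
    (blockIII : ∀ h : ℕ, ∀ hh : 2 ≤ h,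
      ∀ X : Matrix (Fin (h + h + 1) × Fin (h + h + 1)) (Fin (h + h + 1) × Fin (h + h + 1)) ℂ,
      X ∈ glAnn (pLambda (h + h + 1)) →
      (∀ r a : Fin (h + h + 1), r ≠ a →
        (Matrix.of fun k l => ∑ p : Fin (h + h + 1) × Fin (h + h + 1), X p (k, l) *
          (Matrix.single r a (1 : ℂ) + Matrix.single a r (1 : ℂ)) p.1 p.2) r r = 0) →
      (∀ j : Fin (h + h + 1), j ≠ 0 →
        (Matrix.of fun k l => ∑ p : Fin (h + h + 1) × Fin (h + h + 1), X p (k, l) *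
            (Matrix.single (0 : Fin (h + h + 1)) j (1 : ℂ) - Matrix.single j (0 : Fin (h + h + 1)) (1 : ℂ)) p.1 p.2) 0 j -
          (Matrix.of fun k l => ∑ p : Fin (h + h + 1) × Fin (h + h + 1), X p (k, l) *
            (Matrix.single (0 : Fin (h + h + 1)) j (1 : ℂ) - Matrix.single j (0 : Fin (h + h + 1)) (1 : ℂ)) p.1 p.2) j 0 = 0) →
      ((Matrix.of fun k l => ∑ p : Fin (h + h + 1) × Fin (h + h + 1), X p (k, l) *
            (Matrix.single (⟨1, by omega⟩ : Fin (h + h + 1)) (⟨2, by omega⟩ : Fin (h + h + 1)) (1 : ℂ) -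
              Matrix.single (⟨2, by omega⟩ : Fin (h + h + 1)) (⟨1, by omega⟩ : Fin (h + h + 1)) (1 : ℂ)) p.1 p.2)
            (⟨1, by omega⟩ : Fin (h + h + 1)) (⟨2, by omega⟩ : Fin (h + h + 1)) -
        (Matrix.of fun k l => ∑ p : Fin (h + h + 1) × Fin (h + h + 1), X p (k, l) *
            (Matrix.single (⟨1, by omega⟩ : Fin (h + h + 1)) (⟨2, by omega⟩ : Fin (h + h + 1)) (1 : ℂ) -
              Matrix.single (⟨2, by omega⟩ : Fin (h + h + 1)) (⟨1, by omega⟩ : Fin (h + h + 1)) (1 : ℂ)) p.1 p.2)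
            (⟨2, by omega⟩ : Fin (h + h + 1)) (⟨1, by omega⟩ : Fin (h + h + 1)) = 0) →
      ∀ A : Matrix (Fin (h + h + 1)) (Fin (h + h + 1)) ℂ, Aᵀ = -A →
        (1 / 2 : ℂ) • ((Matrix.of fun k l => ∑ p : Fin (h + h + 1) × Fin (h + h + 1), X p (k, l) * A p.1 p.2) -
          (Matrix.of fun k l => ∑ p : Fin (h + h + 1) × Fin (h + h + 1), X p (k, l) * A p.1 p.2)ᵀ) = 0) :
    LMR2013_prop_3_5_1 := by
  refine LMR2013_prop_3_5_1_of_finrank_glAnn_le fun n hn h3 => ?_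
  rw [finrank_glAnn_detPoly]
  obtain ⟨k, hk⟩ := hn
  have hk' : n = k + k + 1 := by omega
  subst hk'
  have hsq : 1 ≤ (k + k + 1) ^ 2 := Nat.one_le_pow _ _ (by omega)
  rcases Nat.lt_or_ge k 2 with hlt | hge
  · have hk1 : k = 1 := by omega
    subst hk1
    show Module.finrank ℂ (glAnn (pLambda 3)) ≤ 2 * 3 ^ 2 - 2 + 1
    rw [finrank_glAnn_pLambda_three]
    norm_num
  · have hle := finrank_glAnn_pLambda_le_of_blocks (h := k) (by omega) (blockI k hge) (blockIII k hge)
    omega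

end Assembly

end SkewAdj

end Literature.Computability.AlgebraicComplexity

end
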